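import Literature.Analysis.FluidPDE.SobolevSixBall
import Literature.Analysis.FluidPDE.MollifiedSolenoidalTest
import Literature.Analysis.FluidPDE.WholeSpaceIBPIntegrable
import Literature.Analysis.FluidPDE.WeakGradientIBP
import Literature.Analysis.FluidPDE.TaoEnstrophyLocalisationProofs
import Literature.Analysis.FunctionSpaces.MollificationLp
import Literature.Analysis.FunctionSpaces.SobolevDomainProofs
import Literature.Analysis.FunctionSpaces.TimeMollification
import Literature.Analysis.FluidPDE.MildL3Restart
import Literature.Analysis.FluidPDE.LerayHopfH1Test
import HarnessLib

/-!
# The product estimate `∫ |a|²|w|² ≤ C ‖a‖²_{L³,uloc} ‖w‖²_{H¹}` and the stretching identity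
# `∫ ⟪Da(w), w⟫ = -∫ ⟪∇w(w), a⟫`

Analysis/FluidPDE theorem file (no definitions, no named facts): the two whole-space estimates
that turn the perturbed energy inequality for `w = u - a` (a Leray solution minus a mild solution
small in `L³_uloc`; Lemarié-Rieusset 2016, Thm. 14.8, proof, Step 2, p. 525: "we may then estimate
`‖α₁ ⊗ w‖_{L²L²}` by `C₀ sup_t ‖α₁‖_{L²_uloc} ‖w‖_{L²H¹}`"; Seregin 2014, App. B, Thm. 5.10) into a
Gronwall inequality:

* `lintegral_lintegral_unitBall_eq` — the averaging identity `∫_z ∫_{B(z,1)} F = |B₁| ∫ F`;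
* `exists_lintegral_sq_mul_sq_le_uloc` — **the product estimate**
  `∫ |a|²|w|² ≤ C N² (‖w‖₂² + ‖∇w‖₂²)` whenever `‖a‖_{L³(B(z,1))} ≤ N` for all `z` and `w ∈ H¹(ℝ³)`
  (Hölder on unit balls, the Sobolev inequality on unit balls with a uniform constant
  `exists_eLpNorm_six_le_ball_uniform`, and the averaging identity);
* `integral_inner_fderiv_apply_eq_neg_of_hasWeakGradient` — **the stretching identity**
  `∫ ⟪Da(w), w⟫ = -∫ ⟪∇w(w), a⟫` for `a ∈ C¹_b` and a weakly divergence-free `w ∈ H¹` (mollify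
  `w`, apply the divergence theorem `∫ div(⟪a, w_ε⟫ w_ε) = 0` of `WholeSpaceIBPIntegrable`, and
  pass to the limit in `L²`).

## References

* P. G. Lemarié-Rieusset, *The Navier–Stokes Problem in the 21st Century* (2016), Thm. 14.8,
  proof, Step 2 (PDF p. 525).
* G. Seregin, *Lecture Notes on Regularity Theory for the Navier–Stokes Equations* (2014),
  App. B, §B.5, Thm. 5.10.
-/

noncomputable section

open MeasureTheory TopologicalSpace Set Function Filter Metric
open _root_.Topology
open scoped ENNReal NNReal RealInnerProductSpace Convolution

namespace Literature.Analysis.FluidPDE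

open ContinuousLinearMap (lsmul)

/-! ### Small helpers -/

/-- `(x + y)² ≤ 2x² + 2y²` in `ℝ≥0∞` (file-local copy of the tree's `ennreal_add_sq_le`). [folklore] -/
private theorem ennreal_add_sq_le₂ (x y : ℝ≥0∞) : (x + y) ^ (2 : ℕ) ≤ 2 * x ^ (2 : ℕ) + 2 * y ^ (2 : ℕ) := by
  have h := ENNReal.rpow_add_le_mul_rpow_add_rpow x y (by norm_num : (1 : ℝ) ≤ 2)
  have e4 : (2 : ℝ≥0∞) ^ ((2 : ℝ) - 1) = 2 := by
    rw [show (2 : ℝ) - 1 = ((1 : ℕ) : ℝ) by norm_num, ENNReal.rpow_natCast, pow_one]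
  have e3 : ∀ z : ℝ≥0∞, z ^ (2 : ℝ) = z ^ (2 : ℕ) := fun z => by
    rw [show (2 : ℝ) = ((2 : ℕ) : ℝ) by norm_num, ENNReal.rpow_natCast]
  simp only [e4, e3] at h
  calc (x + y) ^ (2 : ℕ) ≤ 2 * (x ^ (2 : ℕ) + y ^ (2 : ℕ)) := h
    _ = 2 * x ^ (2 : ℕ) + 2 * y ^ (2 : ℕ) := by ring

/-- `∫⁻ ‖f‖ₑ² = ‖f‖₂²` (file-local). [folklore] -/
private theorem lintegral_enorm_sq_eq_eLpNorm_sq₂ {α : Type*} {m : MeasurableSpace α} (μ : Measure α)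
    {F : Type*} [NormedAddCommGroup F] (f : α → F) : ∫⁻ x, ‖f x‖ₑ ^ 2 ∂μ = eLpNorm f 2 μ ^ 2 := by
  have h := eLpNorm_natCast_pow_eq_lintegral μ f (n := 2) two_ne_zero
  simpa only [Nat.cast_ofNat] using h.symm

/-! ### The averaging identity -/

/-- `z ↦ ∫_{B(z,1)} F` is a.e.-measurable for a.e.-measurable `F ≥ 0`. [folklore] -/
theorem aemeasurable_lintegral_unitBall {F : EuclideanSpace ℝ (Fin 3) → ℝ≥0∞} (hF : AEMeasurable F volume) :
    AEMeasurable (fun z : EuclideanSpace ℝ (Fin 3) => ∫⁻ x in ball z 1, F x) volume := by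
  set Φ : (EuclideanSpace ℝ (Fin 3)) × (EuclideanSpace ℝ (Fin 3)) → ℝ≥0∞ :=
    {p : (EuclideanSpace ℝ (Fin 3)) × (EuclideanSpace ℝ (Fin 3)) | dist p.2 p.1 < 1}.indicator fun p => F p.2 with hΦ
  have hΦm : AEMeasurable Φ (volume.prod volume) := by
    refine hF.comp_snd.indicator ?_
    exact (isOpen_lt (continuous_snd.dist continuous_fst) continuous_const).measurableSet
  have h := hΦm.lintegral_prod_right'
  refine h.congr (Eventually.of_forall fun z => ?_)
  show ∫⁻ x, Φ (z, x) = ∫⁻ x in ball z 1, F x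
  rw [← lintegral_indicator measurableSet_ball]
  refine lintegral_congr fun x => ?_
  simp only [hΦ, indicator, mem_setOf_eq, mem_ball]

/-- **Averaging over unit balls**: `∫_z ∫_{B(z,1)} F = |B₁| ∫ F` for measurable `F ≥ 0` (Fubini;
the continuous form of summing over a lattice of balls). [folklore] -/
theorem lintegral_lintegral_unitBall_eq {F : EuclideanSpace ℝ (Fin 3) → ℝ≥0∞} (hF : AEMeasurable F volume) :
    ∫⁻ z, ∫⁻ x in ball z 1, F x = volume (ball (0 : EuclideanSpace ℝ (Fin 3)) 1) * ∫⁻ x, F x := by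
  set Φ : (EuclideanSpace ℝ (Fin 3)) → (EuclideanSpace ℝ (Fin 3)) → ℝ≥0∞ :=
    fun z x => (ball z 1).indicator F x with hΦ
  have hΦm : AEMeasurable (uncurry Φ) (volume.prod volume) := by
    have e : uncurry Φ =
        {p : (EuclideanSpace ℝ (Fin 3)) × (EuclideanSpace ℝ (Fin 3)) | dist p.2 p.1 < 1}.indicator fun p => F p.2 := by
      funext p
      simp only [hΦ, uncurry, indicator, mem_ball, mem_setOf_eq]
    rw [e]
    refine hF.comp_snd.indicator ?_
    exact (isOpen_lt (continuous_snd.dist continuous_fst) continuous_const).measurableSet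
  have h1 : ∫⁻ z, ∫⁻ x in ball z 1, F x = ∫⁻ z, ∫⁻ x, Φ z x := by
    refine lintegral_congr fun z => ?_
    rw [hΦ, lintegral_indicator measurableSet_ball]
  have h2 : ∫⁻ z, ∫⁻ x, Φ z x = ∫⁻ x, ∫⁻ z, Φ z x := lintegral_lintegral_swap hΦm
  have h3 : ∀ x, ∫⁻ z, Φ z x = volume (ball (0 : EuclideanSpace ℝ (Fin 3)) 1) * F x := fun x => by
    have e : (fun z => Φ z x) = (ball x 1).indicator fun _ => F x := by
      funext z
      simp only [hΦ, indicator, mem_ball]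
      rw [dist_comm]
    rw [e, lintegral_indicator measurableSet_ball, setLIntegral_const, Measure.addHaar_ball_center volume x 1,
      mul_comm]
  rw [h1, h2, lintegral_congr h3, lintegral_const_mul'' _ hF]

/-! ### The product estimate -/

/-- Hölder on a set with exponents `(3/2, 3)` for squares: `∫_B |a|²|w|² ≤ ‖a‖²_{L³(B)} ‖w‖²_{L⁶(B)}`.
[folklore] -/
theorem lintegral_sq_mul_sq_le_eLpNorm_three_six {a w : EuclideanSpace ℝ (Fin 3) → EuclideanSpace ℝ (Fin 3)}
    (μ : Measure (EuclideanSpace ℝ (Fin 3)))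
    (ha : AEStronglyMeasurable a μ) (hw : AEStronglyMeasurable w μ) :
    ∫⁻ x, ‖a x‖ₑ ^ 2 * ‖w x‖ₑ ^ 2 ∂μ ≤ eLpNorm a 3 μ ^ 2 * eLpNorm w 6 μ ^ 2 := by
  have hpq : (3 / 2 : ℝ).HolderConjugate 3 := by rw [Real.holderConjugate_iff]; norm_num
  have h := ENNReal.lintegral_mul_le_Lp_mul_Lq μ hpq (ha.enorm.pow_const 2) (hw.enorm.pow_const 2)
  refine h.trans (le_of_eq ?_)
  have e1 : ∀ x, (‖a x‖ₑ ^ 2) ^ (3 / 2 : ℝ) = ‖a x‖ₑ ^ (3 : ℝ) := fun x => by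
    rw [show (‖a x‖ₑ ^ 2) = ‖a x‖ₑ ^ (2 : ℝ) by rw [show (2 : ℝ) = ((2 : ℕ) : ℝ) by norm_num, ENNReal.rpow_natCast],
      ← ENNReal.rpow_mul]
    norm_num
  have e2 : ∀ x, (‖w x‖ₑ ^ 2) ^ (3 : ℝ) = ‖w x‖ₑ ^ (6 : ℝ) := fun x => by
    rw [show (‖w x‖ₑ ^ 2) = ‖w x‖ₑ ^ (2 : ℝ) by rw [show (2 : ℝ) = ((2 : ℕ) : ℝ) by norm_num, ENNReal.rpow_natCast],
      ← ENNReal.rpow_mul]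
    norm_num
  simp_rw [e1, e2]
  have h3 : eLpNorm a 3 μ = (∫⁻ x, ‖a x‖ₑ ^ (3 : ℝ) ∂μ) ^ (1 / 3 : ℝ) := by
    rw [eLpNorm_eq_lintegral_rpow_enorm_toReal (by norm_num) (by norm_num)]; norm_num
  have h6 : eLpNorm w 6 μ = (∫⁻ x, ‖w x‖ₑ ^ (6 : ℝ) ∂μ) ^ (1 / 6 : ℝ) := by
    rw [eLpNorm_eq_lintegral_rpow_enorm_toReal (by norm_num) (by norm_num)]; norm_num
  rw [h3, h6, ← ENNReal.rpow_natCast, ← ENNReal.rpow_natCast, ← ENNReal.rpow_mul, ← ENNReal.rpow_mul]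
  norm_num

/-- **The product estimate** (Lemarié-Rieusset 2016, proof of Thm. 14.8, Step 2, p. 525:
`‖α₁ ⊗ w‖_{L²} ≤ C₀ ‖α₁‖_{uloc} ‖w‖_{H¹}`; here with the uniformly local `L³` norm of `α₁`).
There is `C < ∞` such that for all fields `a, w` on `ℝ³` with `w ∈ L²`, `∇w = G_w` a weak
gradient, and `‖a‖_{L³(B(z,1))} ≤ N` for every centre `z`,
`∫ |a|²|w|² ≤ C N² (‖w‖₂² + ∫ |G_w|²)` (Frobenius norm). Proof: Hölder and the Sobolev inequality
with a uniform constant on each unit ball, averaged over the centres.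
[cite: LemarieRieusset2016, Thm. 14.8 proof Step 2 (PDF p. 525)] -/
theorem exists_lintegral_sq_mul_sq_le_uloc :
    ∃ C : ℝ≥0∞, C ≠ ⊤ ∧ ∀ (a w : EuclideanSpace ℝ (Fin 3) → EuclideanSpace ℝ (Fin 3))
      (Gw : EuclideanSpace ℝ (Fin 3) → EuclideanSpace ℝ (Fin 3) →L[ℝ] EuclideanSpace ℝ (Fin 3)) (N : ℝ≥0∞),
      AEStronglyMeasurable a volume → MemLp w 2 volume → HasWeakGradient w Gw →
      (∀ z : EuclideanSpace ℝ (Fin 3), eLpNorm a 3 (volume.restrict (ball z 1)) ≤ N) →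
      ∫⁻ x, ‖a x‖ₑ ^ 2 * ‖w x‖ₑ ^ 2 ≤
        C * N ^ 2 * (eLpNorm w 2 volume ^ 2 + ∫⁻ x, ENNReal.ofReal (frobeniusNormSq (Gw x))) := by
  have hE3 : Module.finrank ℝ (EuclideanSpace ℝ (Fin 3)) = 3 := by simp
  obtain ⟨CS, hCS⟩ := exists_eLpNorm_six_le_ball_uniform hE3 (1 : ℝ)
  set V : ℝ≥0∞ := volume (ball (0 : EuclideanSpace ℝ (Fin 3)) 1) with hV
  have hV0 : V ≠ 0 := (measure_ball_pos volume _ one_pos).ne'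
  have hVt : V ≠ ⊤ := measure_ball_lt_top.ne
  refine ⟨2 * (CS : ℝ≥0∞) ^ 2, ENNReal.mul_ne_top ENNReal.ofNat_ne_top (ENNReal.pow_ne_top ENNReal.coe_ne_top), ?_⟩
  intro a w Gw N ham hw2 hG hN
  -- per ball: Hölder and Sobolev
  have hball : ∀ z : EuclideanSpace ℝ (Fin 3), ∫⁻ x in ball z 1, ‖a x‖ₑ ^ 2 * ‖w x‖ₑ ^ 2 ≤
      2 * (CS : ℝ≥0∞) ^ 2 * N ^ 2 *
        (eLpNorm w 2 (volume.restrict (ball z 1)) ^ 2 + ∫⁻ x in ball z 1, ENNReal.ofReal (frobeniusNormSq (Gw x))) := by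
    intro z
    have hGz : FunctionSpaces.HasWeakFDerivOn (⟨ball z 1, isOpen_ball⟩ : Opens (EuclideanSpace ℝ (Fin 3))) volume w Gw :=
      FunctionSpaces.HasWeakFDerivOn.mono_set_holds hG le_top
    have hw2z : eLpNorm w 2 (volume.restrict (ball z 1)) ≠ ⊤ :=
      ne_top_of_le_ne_top hw2.eLpNorm_ne_top (eLpNorm_mono_measure _ Measure.restrict_le_self)
    have hS := hCS z w Gw hGz hw2z
    set D : ℝ≥0∞ := ∫⁻ x in ball z 1, ENNReal.ofReal (frobeniusNormSq (Gw x)) with hD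
    set W2 : ℝ≥0∞ := eLpNorm w 2 (volume.restrict (ball z 1)) with hW2
    calc ∫⁻ x in ball z 1, ‖a x‖ₑ ^ 2 * ‖w x‖ₑ ^ 2
        ≤ eLpNorm a 3 (volume.restrict (ball z 1)) ^ 2 * eLpNorm w 6 (volume.restrict (ball z 1)) ^ 2 :=
          lintegral_sq_mul_sq_le_eLpNorm_three_six _ ham.restrict hw2.1.restrict
      _ ≤ N ^ 2 * ((CS : ℝ≥0∞) * (W2 + D ^ (1 / 2 : ℝ))) ^ 2 := by gcongr; exact hN z
      _ = (CS : ℝ≥0∞) ^ 2 * N ^ 2 * (W2 + D ^ (1 / 2 : ℝ)) ^ 2 := by ring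
      _ ≤ (CS : ℝ≥0∞) ^ 2 * N ^ 2 * (2 * W2 ^ 2 + 2 * (D ^ (1 / 2 : ℝ)) ^ 2) := by
          gcongr; exact ennreal_add_sq_le₂ _ _
      _ = 2 * (CS : ℝ≥0∞) ^ 2 * N ^ 2 * (W2 ^ 2 + D) := by
          have e : (D ^ (1 / 2 : ℝ)) ^ 2 = D := by
            rw [← ENNReal.rpow_natCast, ← ENNReal.rpow_mul]; norm_num
          rw [e]; ring
  -- average over the centres
  have hFm : AEMeasurable (fun x => ‖a x‖ₑ ^ 2 * ‖w x‖ₑ ^ 2) volume :=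
    (ham.enorm.pow_const 2).mul (hw2.1.enorm.pow_const 2)
  have hGm : AEMeasurable (fun x => ENNReal.ofReal (frobeniusNormSq (Gw x))) volume := by
    have hGsm : AEStronglyMeasurable Gw volume := by
      have h := hG.locallyIntegrableOn_deriv
      simp only [Opens.coe_top] at h
      exact (locallyIntegrableOn_univ.1 h).aestronglyMeasurable
    exact (continuous_frobeniusNormSq_clm.comp_aestronglyMeasurable
      hGsm).aemeasurable.ennreal_ofReal
  have hw2m : AEMeasurable (fun x => ‖w x‖ₑ ^ 2) volume := hw2.1.enorm.pow_const 2
  have key : V * ∫⁻ x, ‖a x‖ₑ ^ 2 * ‖w x‖ₑ ^ 2 ≤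
      V * (2 * (CS : ℝ≥0∞) ^ 2 * N ^ 2 * (eLpNorm w 2 volume ^ 2 + ∫⁻ x, ENNReal.ofReal (frobeniusNormSq (Gw x)))) := by
    calc V * ∫⁻ x, ‖a x‖ₑ ^ 2 * ‖w x‖ₑ ^ 2 = ∫⁻ z, ∫⁻ x in ball z 1, ‖a x‖ₑ ^ 2 * ‖w x‖ₑ ^ 2 :=
          (lintegral_lintegral_unitBall_eq hFm).symm
      _ ≤ ∫⁻ z, 2 * (CS : ℝ≥0∞) ^ 2 * N ^ 2 *
          (eLpNorm w 2 (volume.restrict (ball z 1)) ^ 2 + ∫⁻ x in ball z 1, ENNReal.ofReal (frobeniusNormSq (Gw x))) :=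
          lintegral_mono hball
      _ = 2 * (CS : ℝ≥0∞) ^ 2 * N ^ 2 * ((∫⁻ z, ∫⁻ x in ball z 1, ‖w x‖ₑ ^ 2) +
          ∫⁻ z, ∫⁻ x in ball z 1, ENNReal.ofReal (frobeniusNormSq (Gw x))) := by
          have e : ∀ z : EuclideanSpace ℝ (Fin 3), eLpNorm w 2 (volume.restrict (ball z 1)) ^ 2 = ∫⁻ x in ball z 1, ‖w x‖ₑ ^ 2 :=
            fun z => by rw [← lintegral_enorm_sq_eq_eLpNorm_sq₂]
          simp_rw [e]
          have hm1 : AEMeasurable (fun z : EuclideanSpace ℝ (Fin 3) => ∫⁻ x in ball z 1, ‖w x‖ₑ ^ 2) volume :=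
            aemeasurable_lintegral_unitBall hw2m
          have hm2 : AEMeasurable (fun z : EuclideanSpace ℝ (Fin 3) =>
              ∫⁻ x in ball z 1, ENNReal.ofReal (frobeniusNormSq (Gw x))) volume := aemeasurable_lintegral_unitBall hGm
          have hm12 : AEMeasurable (fun z : EuclideanSpace ℝ (Fin 3) => (∫⁻ x in ball z 1, ‖w x‖ₑ ^ 2) +
              ∫⁻ x in ball z 1, ENNReal.ofReal (frobeniusNormSq (Gw x))) volume := hm1.add hm2
          rw [lintegral_const_mul'' _ hm12, lintegral_add_left' hm1]
      _ = 2 * (CS : ℝ≥0∞) ^ 2 * N ^ 2 * (V * (∫⁻ x, ‖w x‖ₑ ^ 2) + V * ∫⁻ x, ENNReal.ofReal (frobeniusNormSq (Gw x))) := by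
          rw [lintegral_lintegral_unitBall_eq hw2m, lintegral_lintegral_unitBall_eq hGm]
      _ = V * (2 * (CS : ℝ≥0∞) ^ 2 * N ^ 2 * (eLpNorm w 2 volume ^ 2 + ∫⁻ x, ENNReal.ofReal (frobeniusNormSq (Gw x)))) := by
          rw [lintegral_enorm_sq_eq_eLpNorm_sq₂]; ring
  exact (ENNReal.mul_le_mul_iff_right hV0 hVt).1 key


/-! ### The stretching identity -/

/-- **The stretching identity for a smooth field** (the divergence theorem on the whole space,
`∫ div (⟪a, v⟫ v) = 0` for `div v = 0`): for `a ∈ C¹` bounded with bounded derivative and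
`v ∈ C¹ ∩ L²` divergence free with `∇v ∈ L²`, `∫ ⟪Da(v), v⟫ = -∫ ⟪∇v(v), a⟫`. [folklore] -/
theorem integral_inner_fderiv_apply_eq_neg_of_contDiff
    {a v : EuclideanSpace ℝ (Fin 3) → EuclideanSpace ℝ (Fin 3)}
    (ha : ContDiff ℝ 1 a) {M Ma : ℝ} (haM : ∀ x, ‖a x‖ ≤ M) (hDaM : ∀ x, ‖fderiv ℝ a x‖ ≤ Ma)
    (hv : ContDiff ℝ 1 v) (hv2 : MemLp v 2 volume) (hDv2 : MemLp (fderiv ℝ v) 2 volume)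
    (hdiv : VectorCalculus.IsDivFree v) :
    ∫ x, ⟪fderiv ℝ a x (v x), v x⟫ = -∫ x, ⟪fderiv ℝ v x (v x), a x⟫ := by
  have hM0 : 0 ≤ M := (norm_nonneg _).trans (haM 0)
  have hMa0 : 0 ≤ Ma := (norm_nonneg _).trans (hDaM 0)
  have hvd : Differentiable ℝ v := hv.differentiable one_ne_zero
  have had : Differentiable ℝ a := ha.differentiable one_ne_zero
  -- the field `Φ = ⟪a, v⟫ v`
  set θ : EuclideanSpace ℝ (Fin 3) → ℝ := fun x => ⟪a x, v x⟫ with hθ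
  have hθ1 : ContDiff ℝ 1 θ := ha.inner ℝ hv
  set Φ : EuclideanSpace ℝ (Fin 3) → EuclideanSpace ℝ (Fin 3) := fun x => θ x • v x with hΦ
  have hΦ1 : ContDiff ℝ 1 Φ := hθ1.smul hv
  -- its divergence
  have hdivΦ : ∀ x, VectorCalculus.divergence Φ x = ⟪fderiv ℝ a x (v x), v x⟫ + ⟪fderiv ℝ v x (v x), a x⟫ := by
    intro x
    have h1 := divergence_smul_apply (θ := θ) (u := v) (hθ1.differentiable one_ne_zero x) (hvd x)
    rw [show (fun y => θ y • v y) = Φ from rfl] at h1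
    rw [h1, hdiv x, mul_zero, zero_add, inner_gradient_eq_fderiv_apply,
      fderiv_inner_apply ℝ (had x) (hvd x), real_inner_comm (a x)]
    ring
  -- integrability of `Φ` and `div Φ`
  have hv2i : Integrable (fun x => ‖v x‖ ^ 2) volume := (memLp_two_iff_integrable_sq_norm hv2.1).1 hv2
  have hDv2i : Integrable (fun x => ‖fderiv ℝ v x‖ ^ 2) volume := (memLp_two_iff_integrable_sq_norm hDv2.1).1 hDv2
  have hΦi : Integrable Φ volume := by
    refine (hv2i.const_mul M).mono' hΦ1.continuous.aestronglyMeasurable (Eventually.of_forall fun x => ?_)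
    calc ‖Φ x‖ = |θ x| * ‖v x‖ := by rw [hΦ]; exact norm_smul _ _
      _ ≤ (‖a x‖ * ‖v x‖) * ‖v x‖ := by gcongr; exact abs_real_inner_le_norm _ _
      _ ≤ (M * ‖v x‖) * ‖v x‖ := by gcongr; exact haM x
      _ = M * ‖v x‖ ^ 2 := by ring
  have hf1i : Integrable (fun x => ⟪fderiv ℝ a x (v x), v x⟫) volume := by
    have hm : AEStronglyMeasurable (fun x => ⟪fderiv ℝ a x (v x), v x⟫) volume :=
      (((ha.continuous_fderiv one_ne_zero).clm_apply hv.continuous).inner hv.continuous).aestronglyMeasurable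
    refine (hv2i.const_mul Ma).mono' hm (Eventually.of_forall fun x => ?_)
    calc ‖⟪fderiv ℝ a x (v x), v x⟫‖ ≤ ‖fderiv ℝ a x (v x)‖ * ‖v x‖ := norm_inner_le_norm _ _
      _ ≤ (‖fderiv ℝ a x‖ * ‖v x‖) * ‖v x‖ := by gcongr; exact ContinuousLinearMap.le_opNorm _ _
      _ ≤ (Ma * ‖v x‖) * ‖v x‖ := by gcongr; exact hDaM x
      _ = Ma * ‖v x‖ ^ 2 := by ring
  have hf2i : Integrable (fun x => ⟪fderiv ℝ v x (v x), a x⟫) volume := by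
    have hm : AEStronglyMeasurable (fun x => ⟪fderiv ℝ v x (v x), a x⟫) volume :=
      (((hv.continuous_fderiv one_ne_zero).clm_apply hv.continuous).inner ha.continuous).aestronglyMeasurable
    refine (((hDv2i.add hv2i).const_mul (M / 2))).mono' hm (Eventually.of_forall fun x => ?_)
    calc ‖⟪fderiv ℝ v x (v x), a x⟫‖ ≤ ‖fderiv ℝ v x (v x)‖ * ‖a x‖ := norm_inner_le_norm _ _
      _ ≤ (‖fderiv ℝ v x‖ * ‖v x‖) * M := by
          gcongr
          · exact ContinuousLinearMap.le_opNorm _ _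
          · exact haM x
      _ ≤ M / 2 * (‖fderiv ℝ v x‖ ^ 2 + ‖v x‖ ^ 2) := by
          nlinarith [sq_nonneg (‖fderiv ℝ v x‖ - ‖v x‖), norm_nonneg (fderiv ℝ v x), norm_nonneg (v x)]
  have hdivi : Integrable (fun x => VectorCalculus.divergence Φ x) volume := by
    have e : (fun x => VectorCalculus.divergence Φ x) = fun x => ⟪fderiv ℝ a x (v x), v x⟫ + ⟪fderiv ℝ v x (v x), a x⟫ :=
      funext hdivΦ
    rw [e]; exact hf1i.add hf2i
  have h0 := integral_divergence_eq_zero_of_integrable hΦ1 hΦi hdivi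
  simp_rw [hdivΦ] at h0
  rw [integral_add hf1i hf2i] at h0
  linarith

/-- `‖L v‖₂ ≤ M ‖v‖₂`-type bound: the `L²` norm of `x ↦ A(x)(f x)` for operators bounded by `Ma`.
[folklore] -/
theorem eLpNorm_clm_apply_le_of_opNorm_le {f : EuclideanSpace ℝ (Fin 3) → EuclideanSpace ℝ (Fin 3)}
    {A : EuclideanSpace ℝ (Fin 3) → EuclideanSpace ℝ (Fin 3) →L[ℝ] EuclideanSpace ℝ (Fin 3)} {Ma : ℝ}
    (hMa : 0 ≤ Ma) (hA : ∀ x, ‖A x‖ ≤ Ma) :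
    eLpNorm (fun x => A x (f x)) 2 volume ≤ ENNReal.ofReal Ma * eLpNorm f 2 volume := by
  have h := eLpNorm_le_nnreal_smul_eLpNorm_of_ae_le_mul (p := 2) (μ := volume) (f := fun x => A x (f x)) (g := f)
    (c := Ma.toNNReal) (Eventually.of_forall fun x => ?_)
  · rwa [ENNReal.smul_def, smul_eq_mul, ← ENNReal.ofReal_coe_nnreal, Real.coe_toNNReal _ hMa] at h
  · calc ‖A x (f x)‖ ≤ ‖A x‖ * ‖f x‖ := ContinuousLinearMap.le_opNorm _ _
      _ ≤ Ma * ‖f x‖ := by gcongr; exact hA x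
      _ = Ma.toNNReal * ‖f x‖ := by rw [Real.coe_toNNReal _ hMa]

set_option maxHeartbeats 1600000 in
/-- **The stretching identity** `∫ ⟪Da(w), w⟫ = -∫ ⟪∇w(w), a⟫` for a `C¹` field `a` bounded
with bounded derivative and a weakly divergence-free `w ∈ L²(ℝ³)` with weak gradient
`∇w = G_w ∈ L²` (mollify `w`: `w_ε = ρ_ε * w` is smooth, divergence free, `∇w_ε = ρ_ε * G_w`,
`w_ε → w`, `∇w_ε → G_w` in `L²`; the smooth identity
`integral_inner_fderiv_apply_eq_neg_of_contDiff` passes to the limit). This is the integration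
by parts `∫ (α₁·∇w)·w`-free form of the stretching term in the energy balance of
`∂ₜw - Δw + div(w⊗w + α₁⊗w + w⊗α₁) + ∇q = 0` (Lemarié-Rieusset 2016, p. 525). [folklore] -/
theorem integral_inner_fderiv_apply_eq_neg_of_hasWeakGradient
    {a w : EuclideanSpace ℝ (Fin 3) → EuclideanSpace ℝ (Fin 3)}
    {Gw : EuclideanSpace ℝ (Fin 3) → EuclideanSpace ℝ (Fin 3) →L[ℝ] EuclideanSpace ℝ (Fin 3)}
    (ha : ContDiff ℝ 1 a) {M Ma : ℝ} (haM : ∀ x, ‖a x‖ ≤ M) (hDaM : ∀ x, ‖fderiv ℝ a x‖ ≤ Ma)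
    (hw2 : MemLp w 2 volume) (hG : HasWeakGradient w Gw) (hG2 : MemLp Gw 2 volume)
    (hdiv : IsWeaklyDivFree w) :
    ∫ x, ⟪fderiv ℝ a x (w x), w x⟫ = -∫ x, ⟪Gw x (w x), a x⟫ := by
  have hM0 : 0 ≤ M := (norm_nonneg _).trans (haM 0)
  have hMa0 : 0 ≤ Ma := (norm_nonneg _).trans (hDaM 0)
  have hwloc : LocallyIntegrable w volume := hw2.locallyIntegrable (by norm_num)
  have hwm : AEStronglyMeasurable w volume := hw2.1
  have hGm : AEStronglyMeasurable Gw volume := hG2.1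
  have ham : AEStronglyMeasurable a volume := ha.continuous.aestronglyMeasurable
  have hDam : AEStronglyMeasurable (fderiv ℝ a) volume := (ha.continuous_fderiv one_ne_zero).aestronglyMeasurable
  -- ## the mollified fields
  obtain ⟨φ, hφ, -⟩ := FunctionSpaces.exists_contDiffBump_seq (E := EuclideanSpace ℝ (Fin 3))
  set wk : ℕ → EuclideanSpace ℝ (Fin 3) → EuclideanSpace ℝ (Fin 3) :=
    fun k => (φ k).normed volume ⋆[lsmul ℝ ℝ, volume] w with hwk
  set Dk : ℕ → EuclideanSpace ℝ (Fin 3) → EuclideanSpace ℝ (Fin 3) →L[ℝ] EuclideanSpace ℝ (Fin 3) :=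
    fun k => (φ k).normed volume ⋆[lsmul ℝ ℝ, volume] Gw with hDk
  have hwk1 : ∀ k, ContDiff ℝ 1 (wk k) := fun k =>
    hG.contDiff_convolution (FunctionSpaces.isTestFunctionOn_normed (φ k))
  have hDwk : ∀ k, fderiv ℝ (wk k) = Dk k := fun k =>
    funext fun x => (hG.hasFDerivAt_convolution (FunctionSpaces.isTestFunctionOn_normed (φ k)) x).fderiv
  have hwk2 : ∀ k, MemLp (wk k) 2 volume := fun k => FunctionSpaces.memLp_normed_convolution (φ k) hw2 (by norm_num)
  have hDk2 : ∀ k, MemLp (Dk k) 2 volume := fun k => FunctionSpaces.memLp_normed_convolution (φ k) hG2 (by norm_num)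
  have hDwk2 : ∀ k, MemLp (fderiv ℝ (wk k)) 2 volume := fun k => by rw [hDwk k]; exact hDk2 k
  have hdivk : ∀ k, VectorCalculus.IsDivFree (wk k) := fun k =>
    isDivFree_normed_convolution_of_isWeaklyDivFree (φ k) hwloc hdiv
  have hwkle : ∀ k, eLpNorm (wk k) 2 volume ≤ eLpNorm w 2 volume := fun k =>
    FunctionSpaces.eLpNorm_normed_convolution_le (φ k) hwm (by norm_num)
  -- the smooth identities
  have hidk : ∀ k, ∫ x, ⟪fderiv ℝ a x (wk k x), wk k x⟫ = -∫ x, ⟪Dk k x (wk k x), a x⟫ := fun k => by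
    have h := integral_inner_fderiv_apply_eq_neg_of_contDiff ha haM hDaM (hwk1 k) (hwk2 k) (hDwk2 k) (hdivk k)
    simpa only [hDwk k] using h
  -- ## `L²` convergence
  have hconv : Tendsto (fun k => eLpNorm (wk k - w) 2 volume) atTop (𝓝 0) :=
    FunctionSpaces.tendsto_eLpNorm_normed_convolution_sub_self hφ (by norm_num) (by norm_num) hw2
  have hDconv : Tendsto (fun k => eLpNorm (Dk k - Gw) 2 volume) atTop (𝓝 0) :=
    FunctionSpaces.tendsto_eLpNorm_normed_convolution_sub_self hφ (by norm_num) (by norm_num) hG2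
  -- finiteness of the norms
  have hw2t : eLpNorm w 2 volume ≠ ⊤ := hw2.eLpNorm_ne_top
  have hG2t : eLpNorm Gw 2 volume ≠ ⊤ := hG2.eLpNorm_ne_top
  -- ## integrability of the pairings (products of `L²` fields with bounded factors)
  have hAf2 : ∀ {f : EuclideanSpace ℝ (Fin 3) → EuclideanSpace ℝ (Fin 3)}, MemLp f 2 volume →
      MemLp (fun x => fderiv ℝ a x (f x)) 2 volume := fun {f} hf =>
    ⟨isBoundedBilinearMap_apply.continuous.comp_aestronglyMeasurable (hDam.prodMk hf.1),
      (eLpNorm_clm_apply_le_of_opNorm_le hMa0 hDaM).trans_lt (ENNReal.mul_lt_top ENNReal.ofReal_lt_top hf.eLpNorm_lt_top)⟩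
  have hI1i : ∀ {f g : EuclideanSpace ℝ (Fin 3) → EuclideanSpace ℝ (Fin 3)}, MemLp f 2 volume → MemLp g 2 volume →
      Integrable (fun x => ⟪fderiv ℝ a x (f x), g x⟫) volume := fun hf hg =>
    integrable_inner_of_memLp_conj (p := 2) (q := 2) (hAf2 hf) hg
  -- `x ↦ A x (f x)` is in `L¹` for `A, f ∈ L²`, and its pairing with the bounded `a` is integrable
  have hI2i : ∀ {A : EuclideanSpace ℝ (Fin 3) → EuclideanSpace ℝ (Fin 3) →L[ℝ] EuclideanSpace ℝ (Fin 3)}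
      {f : EuclideanSpace ℝ (Fin 3) → EuclideanSpace ℝ (Fin 3)}, MemLp A 2 volume → MemLp f 2 volume →
      Integrable (fun x => ⟪A x (f x), a x⟫) volume := by
    intro A f hA hf
    have hAfm : AEStronglyMeasurable (fun x => A x (f x)) volume :=
      isBoundedBilinearMap_apply.continuous.comp_aestronglyMeasurable (hA.1.prodMk hf.1)
    have h1 : Integrable (fun x => ‖A x‖ * ‖f x‖) volume := by
      have h := (hf.norm.mul' hA.norm : MemLp (fun x => ‖A x‖ * ‖f x‖) 1 volume)
      exact memLp_one_iff_integrable.1 h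
    refine (h1.const_mul M).mono' (hAfm.inner ham) (Eventually.of_forall fun x => ?_)
    calc ‖⟪A x (f x), a x⟫‖ ≤ ‖A x (f x)‖ * ‖a x‖ := norm_inner_le_norm _ _
      _ ≤ (‖A x‖ * ‖f x‖) * M := by gcongr; exacts [ContinuousLinearMap.le_opNorm _ _, haM x]
      _ = M * (‖A x‖ * ‖f x‖) := by ring
  -- ## the limit of `∫ ⟪Da(w_k), w_k⟫`
  have hL1 : Tendsto (fun k => ∫ x, ⟪fderiv ℝ a x (wk k x), wk k x⟫) atTop (𝓝 (∫ x, ⟪fderiv ℝ a x (w x), w x⟫)) := by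
    refine tendsto_of_enorm_sub_le (e := fun k => 2 * (ENNReal.ofReal Ma * eLpNorm w 2 volume) * eLpNorm (wk k - w) 2 volume)
      (fun k => ?_) ?_
    · have hdw : MemLp (wk k - w) 2 volume := (hwk2 k).sub hw2
      have j1 := hI1i hdw (hwk2 k)
      have j2 := hI1i hw2 hdw
      have e : (∫ x, ⟪fderiv ℝ a x (wk k x), wk k x⟫) - ∫ x, ⟪fderiv ℝ a x (w x), w x⟫ =
          (∫ x, ⟪fderiv ℝ a x ((wk k - w) x), wk k x⟫) + ∫ x, ⟪fderiv ℝ a x (w x), (wk k - w) x⟫ := by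
        rw [← integral_sub (hI1i (hwk2 k) (hwk2 k)) (hI1i hw2 hw2), ← integral_add j1 j2]
        refine integral_congr_ae (Eventually.of_forall fun x => ?_)
        simp only [Pi.sub_apply, map_sub, inner_sub_left, inner_sub_right]
        ring
      rw [e]
      calc ‖(∫ x, ⟪fderiv ℝ a x ((wk k - w) x), wk k x⟫) + ∫ x, ⟪fderiv ℝ a x (w x), (wk k - w) x⟫‖ₑ
          ≤ ‖∫ x, ⟪fderiv ℝ a x ((wk k - w) x), wk k x⟫‖ₑ + ‖∫ x, ⟪fderiv ℝ a x (w x), (wk k - w) x⟫‖ₑ := enorm_add_le _ _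
        _ ≤ eLpNorm (fun x => fderiv ℝ a x ((wk k - w) x)) 2 volume * eLpNorm (wk k) 2 volume +
            eLpNorm (fun x => fderiv ℝ a x (w x)) 2 volume * eLpNorm (wk k - w) 2 volume :=
            add_le_add (FunctionSpaces.enorm_integral_inner_le_eLpNorm_mul (hAf2 hdw).1 (hwk2 k).1)
              (FunctionSpaces.enorm_integral_inner_le_eLpNorm_mul (hAf2 hw2).1 hdw.1)
        _ ≤ (ENNReal.ofReal Ma * eLpNorm (wk k - w) 2 volume) * eLpNorm w 2 volume +
            (ENNReal.ofReal Ma * eLpNorm w 2 volume) * eLpNorm (wk k - w) 2 volume := by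
            gcongr
            · exact eLpNorm_clm_apply_le_of_opNorm_le hMa0 hDaM
            · exact hwkle k
            · exact eLpNorm_clm_apply_le_of_opNorm_le hMa0 hDaM
        _ = 2 * (ENNReal.ofReal Ma * eLpNorm w 2 volume) * eLpNorm (wk k - w) 2 volume := by ring
    · have h := ENNReal.Tendsto.const_mul hconv (a := 2 * (ENNReal.ofReal Ma * eLpNorm w 2 volume))
        (Or.inr (ENNReal.mul_ne_top ENNReal.ofNat_ne_top (ENNReal.mul_ne_top ENNReal.ofReal_ne_top hw2t)))
      simpa only [mul_zero] using h
  -- ## the limit of `∫ ⟪D w_k (w_k), a⟫`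
  have hL2 : Tendsto (fun k => ∫ x, ⟪Dk k x (wk k x), a x⟫) atTop (𝓝 (∫ x, ⟪Gw x (w x), a x⟫)) := by
    refine tendsto_of_enorm_sub_le
      (e := fun k => ENNReal.ofReal M * (eLpNorm w 2 volume * eLpNorm (Dk k - Gw) 2 volume +
        eLpNorm Gw 2 volume * eLpNorm (wk k - w) 2 volume)) (fun k => ?_) ?_
    · have hdw : MemLp (wk k - w) 2 volume := (hwk2 k).sub hw2
      have hdD : MemLp (Dk k - Gw) 2 volume := (hDk2 k).sub hG2
      have j1 := hI2i hdD (hwk2 k)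
      have j2 := hI2i hG2 hdw
      have e : (∫ x, ⟪Dk k x (wk k x), a x⟫) - ∫ x, ⟪Gw x (w x), a x⟫ =
          (∫ x, ⟪(Dk k - Gw) x (wk k x), a x⟫) + ∫ x, ⟪Gw x ((wk k - w) x), a x⟫ := by
        rw [← integral_sub (hI2i (hDk2 k) (hwk2 k)) (hI2i hG2 hw2), ← integral_add j1 j2]
        refine integral_congr_ae (Eventually.of_forall fun x => ?_)
        simp only [Pi.sub_apply, map_sub, inner_sub_left, _root_.FunLike.coe_sub, Pi.sub_apply]
        ring
      rw [e]
      have hb : ∀ {A : EuclideanSpace ℝ (Fin 3) → EuclideanSpace ℝ (Fin 3) →L[ℝ] EuclideanSpace ℝ (Fin 3)}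
          {f : EuclideanSpace ℝ (Fin 3) → EuclideanSpace ℝ (Fin 3)}, AEStronglyMeasurable A volume →
          AEStronglyMeasurable f volume →
          ‖∫ x, ⟪A x (f x), a x⟫‖ₑ ≤ ENNReal.ofReal M * (eLpNorm f 2 volume * eLpNorm A 2 volume) := by
        intro A f hA hf
        calc ‖∫ x, ⟪A x (f x), a x⟫‖ₑ ≤ ∫⁻ x, ‖⟪A x (f x), a x⟫‖ₑ := enorm_integral_le_lintegral_enorm _
          _ ≤ ∫⁻ x, ENNReal.ofReal M * (‖f x‖ₑ * ‖A x‖ₑ) := by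
              refine lintegral_mono fun x => ?_
              rw [← ofReal_norm, ← ofReal_norm, ← ofReal_norm, ← ENNReal.ofReal_mul (norm_nonneg _),
                ← ENNReal.ofReal_mul hM0]
              refine ENNReal.ofReal_le_ofReal ?_
              calc ‖⟪A x (f x), a x⟫‖ ≤ ‖A x (f x)‖ * ‖a x‖ := norm_inner_le_norm _ _
                _ ≤ (‖A x‖ * ‖f x‖) * M := by gcongr; exacts [ContinuousLinearMap.le_opNorm _ _, haM x]
                _ = M * (‖f x‖ * ‖A x‖) := by ring
          _ = ENNReal.ofReal M * ∫⁻ x, ‖f x‖ₑ * ‖A x‖ₑ := by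
              have hm : AEMeasurable (fun x => ‖f x‖ₑ * ‖A x‖ₑ) volume := hf.enorm.mul hA.enorm
              rw [lintegral_const_mul'' _ hm]
          _ ≤ ENNReal.ofReal M * (eLpNorm f 2 volume * eLpNorm A 2 volume) := by
              gcongr; exact FunctionSpaces.lintegral_enorm_mul_enorm_le_eLpNorm_mul hf hA
      calc ‖(∫ x, ⟪(Dk k - Gw) x (wk k x), a x⟫) + ∫ x, ⟪Gw x ((wk k - w) x), a x⟫‖ₑ
          ≤ ‖∫ x, ⟪(Dk k - Gw) x (wk k x), a x⟫‖ₑ + ‖∫ x, ⟪Gw x ((wk k - w) x), a x⟫‖ₑ := enorm_add_le _ _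
        _ ≤ ENNReal.ofReal M * (eLpNorm (wk k) 2 volume * eLpNorm (Dk k - Gw) 2 volume) +
            ENNReal.ofReal M * (eLpNorm (wk k - w) 2 volume * eLpNorm Gw 2 volume) :=
            add_le_add (hb hdD.1 (hwk2 k).1) (hb hG2.1 hdw.1)
        _ ≤ ENNReal.ofReal M * (eLpNorm w 2 volume * eLpNorm (Dk k - Gw) 2 volume) +
            ENNReal.ofReal M * (eLpNorm (wk k - w) 2 volume * eLpNorm Gw 2 volume) := by
            gcongr; exact hwkle k
        _ = _ := by ring
    · have h1 := ENNReal.Tendsto.const_mul hDconv (a := eLpNorm w 2 volume) (Or.inr hw2t)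
      have h2 := ENNReal.Tendsto.const_mul hconv (a := eLpNorm Gw 2 volume) (Or.inr hG2t)
      simp only [mul_zero] at h1 h2
      have h3 := h1.add h2
      simp only [add_zero] at h3
      have h4 := ENNReal.Tendsto.const_mul h3 (a := ENNReal.ofReal M) (Or.inr ENNReal.ofReal_ne_top)
      simpa only [mul_zero] using h4
  -- ## conclusion
  have hL1' : Tendsto (fun k => ∫ x, ⟪fderiv ℝ a x (wk k x), wk k x⟫) atTop (𝓝 (-∫ x, ⟪Gw x (w x), a x⟫)) := by
    simp_rw [hidk]
    exact hL2.neg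
  exact tendsto_nhds_unique hL1 hL1'

end Literature.Analysis.FluidPDE
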